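import Summits.HodgeConjecture.CorCM.Census.CyclicCharacterBalancedRelationK

/-!
# Cyclic characters, XLVI: PREREQUISITES OF THE `d = 0` CERTIFICATE for every `k` — the non-root with `w g = 1`, interval data of pure ties and balanced
# types, the excluded block, the spectator ties, and the top unit shift

COR-CM (cell `pub-hodgecm2`), count-neutral kernel combinatorics by the binder seat b09 (gen 44; lane CYCLIC-CHARACTER FIBRE LAW, part XLVI — groundwork for
the `k ≥ 3` version of part XXXIX, cf. `HOME/pub-hodgecm2-b09/lean-g44/LOWER-RULE-ROADMAP.md`), on parts XXII (`unitShift_transport`), XXIV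
(`rt_arcType_eq_zero_or_one_of_tie`), XLI–XLV BY NAME.  Theorems only (no definition, no `decide`, no certificate, no named fact, no `sorry`).
HONEST FRAMING: `HC_CM` is NOT proved, here or anywhere in the tree; nothing here is a period or a headline.

* §1 from a `w`-odd non-root a non-root `g` with `w g = 1` (`g ↦ g^j`, `j·w g = 1`; `⟨g^j⟩ ≤ ⟨g⟩`);
* §2 a pure bottom tie carries the interval datum `(1, 1)`; a type all of whose arc distances are equal (the balanced block) carries NO proper interval datum;
* §3 **the excluded block misses the sub-balanced types**: a sub-balanced `Z` with `x_0(Z) = m`, bottom deviation inside `B = T_0 ∖ X_B`, in the block of a type of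
  potential `m` must be `X_B` (`bpot Z = ddist T_0 Z ≥ x_0(Z) = m` with equality forcing the deviation to be bottom);
* §4 the spectator tie `X_B^{(u)}` (`w u ∈ [1, h−2]`) is sub-balanced with `x_{h−1} < m`;
* §5 **THE TOP UNIT SHIFT** from the top arc shift and the interior unit shifts: `unit_0(u) = Y(u) − Σ_{a=1}^{h−2} unit_a(u)` for `w u = h − 1`.

## References
* [Pohlmann1968] H. Pohlmann, Algebraic cycles on abelian varieties of complex multiplication type, Ann. of Math. 88 (1968), Thm 1.
-/

namespace Summit.HodgeConjecture.CorCM.Census.CyclicCharacter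

open Finset
open Summit.HodgeConjecture.CorCM.Prior.AllgGroup.RfwfAllgGroup
open Summit.HodgeConjecture.CorCM.Census.BlockParity
open Summit.HodgeConjecture.CorCM.Census.Coinvariant
open Summit.HodgeConjecture.CorCM.Census.TwistGeneration
open Summit.HodgeConjecture.CorCM.Census.BaseBlock

noncomputable section

variable {G : Type*} [Group G] [Fintype G] [DecidableEq G] {k : ℕ} {w : G → ZMod (2 ^ k)} {c : G}

/-! ## §1 A non-root with `w g = 1` -/

omit [Fintype G] [DecidableEq G] in
/-- **A NON-ROOT WITH `w g = 1`** (every `k`): if some `g` with `w g` odd has `c ∉ ⟨g⟩`, then some power of it has `w = 1` and still `c ∉ ⟨·⟩`. [folklore] -/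
theorem exists_apply_eq_one_notMem_zpowers_gen (hw : ∀ P Q : G, w (P * Q) = w P + w Q)
    (hnon : ∃ g : G, ¬ 2 ∣ (w g).val ∧ c ∉ Subgroup.zpowers g) : ∃ g : G, w g = 1 ∧ c ∉ Subgroup.zpowers g := by
  haveI : NeZero (2 ^ k) := ⟨pow_ne_zero _ two_ne_zero⟩
  obtain ⟨g, hodd, hgc⟩ := hnon
  have hcop : Nat.Coprime (w g).val (2 ^ k) :=
    Nat.Coprime.pow_right k (Nat.coprime_comm.mp ((Nat.Prime.coprime_iff_not_dvd Nat.prime_two).mpr hodd))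
  have hunit : IsUnit (w g) := by rw [← ZMod.natCast_zmod_val (w g)]; exact (ZMod.isUnit_iff_coprime _ _).mpr hcop
  obtain ⟨v, hv⟩ := hunit.exists_left_inv
  refine ⟨g ^ v.val, ?_, fun h => hgc (Subgroup.zpowers_le.mpr (Subgroup.pow_mem _ (Subgroup.mem_zpowers g) _) h)⟩
  rw [map_pow hw, nsmul_eq_mul, ZMod.natCast_zmod_val, hv]

/-! ## §2 Interval data: pure ties yes, balanced types no -/

/-- **A PURE BOTTOM TIE CARRIES THE INTERVAL DATUM `(1, 1)`**: its nearest arc types are exactly `T_0` and `T_1` (`k ≥ 2`). [folklore] -/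
theorem intDatum_of_pureTie (hw : ∀ P Q : G, w (P * Q) = w P + w Q) (hk : 1 ≤ k) (hk2 : 2 ≤ k) (hc2 : c * c = 1) (hwc : w c ≠ 0)
    (h1 : ∃ g₁ : G, w g₁ = 1) {X : CMF G c} (hX : (arcType hw hk hc2 hwc 0).1 \ X.1 ⊆ univ.filter fun s : G => w s = 0)
    (h2 : 2 * ((arcType hw hk hc2 hwc 0).1 \ X.1).card = (univ.filter fun s : G => w s = 0).card) (hne : ((arcType hw hk hc2 hwc 0).1 \ X.1).Nonempty)
    (P : G) : bpot c (arcType hw hk hc2 hwc 0) X = ddist (rt c P (arcType hw hk hc2 hwc 0)) X ↔ ∃ i : ℕ, i ≤ 1 ∧ w P = w (1 : G) - (i : ZMod (2 ^ k)) := by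
  have hpot := bpot_eq_of_tie hw hk hc2 hwc h2
  have hd1 := ddist_arcType_one_add hw hk hc2 hwc X hX
  rw [map_one hw]
  constructor
  · intro h
    rcases rt_arcType_eq_zero_or_one_of_tie hw hk hk2 hc2 hwc h1 hX h2 hne (by rw [← h, hpot]) with h0 | h0
    · refine ⟨0, zero_le_one, ?_⟩
      have := (rt_arcType_eq_self_iff hw hk hc2 hwc h1 P 0).mp h0
      rw [this, Nat.cast_zero, sub_zero]
    · refine ⟨1, le_rfl, ?_⟩
      rw [rt_arcType_zero_eq] at h0
      have := arcType_injective hw hk hc2 hwc h1 h0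
      rw [Nat.cast_one, zero_sub, ← this, neg_neg]
  · rintro ⟨i, hi, hP⟩
    interval_cases i
    · rw [Nat.cast_zero, sub_zero] at hP
      rw [rt_arcType_zero_of_ker hw hk hc2 hwc hP, hpot]; rfl
    · rw [Nat.cast_one, zero_sub] at hP
      rw [← arcType_eq_rt hw hk hc2 hwc (a := 1) hP, hpot]; omega

/-- **A TYPE EQUIDISTANT FROM ALL ARC TYPES CARRIES NO PROPER INTERVAL DATUM.** [folklore] -/
theorem not_intDatum_of_equidistant (hw : ∀ P Q : G, w (P * Q) = w P + w Q) (hk : 1 ≤ k) (hc2 : c * c = 1) (hwc : w c ≠ 0)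
    (h1 : ∃ g₁ : G, w g₁ = 1) {Z : CMF G c} (hZ : ∀ P : G, bpot c (arcType hw hk hc2 hwc 0) Z = ddist (rt c P (arcType hw hk hc2 hwc 0)) Z)
    {Q : G} {r : ℕ} (hr : r + 1 < 2 ^ k)
    (hQ : ∀ P : G, bpot c (arcType hw hk hc2 hwc 0) Z = ddist (rt c P (arcType hw hk hc2 hwc 0)) Z ↔ ∃ i : ℕ, i ≤ r ∧ w P = w Q - (i : ZMod (2 ^ k))) :
    False := by
  obtain ⟨P, hP⟩ := exists_apply_eq hw h1 (w Q - ((r + 1 : ℕ) : ZMod (2 ^ k)))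
  obtain ⟨i, hi, hPi⟩ := (hQ P).mp (hZ P)
  rw [hP] at hPi
  have e : ((r + 1 : ℕ) : ZMod (2 ^ k)) = (i : ZMod (2 ^ k)) := by
    have := congrArg (fun x => w Q - x) hPi; simpa using this
  have := congrArg ZMod.val e
  rw [ZMod.val_cast_of_lt hr, ZMod.val_cast_of_lt (by omega)] at this
  omega

/-- **All arc distances of the balanced type are equal** (hence so are those of every type of its block). [folklore] -/
theorem bpot_eq_ddist_of_blk_eq_balanced (hw : ∀ P Q : G, w (P * Q) = w P + w Q) (hk : 1 ≤ k) (hc2 : c * c = 1) (hwc : w c ≠ 0)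
    (h1 : ∃ g₁ : G, w g₁ = 1) {m : ℕ} (hm : 2 * m = (univ.filter fun s : G => w s = 0).card) {Ψ : CMF G c} {g : G} (hΨ : rt c g Ψ = Ψ)
    (hg : w g = 1) {Z : CMF G c} (hZ : blk c Z = blk c Ψ) (P : G) :
    bpot c (arcType hw hk hc2 hwc 0) Z = ddist (rt c P (arcType hw hk hc2 hwc 0)) Z := by
  obtain ⟨P₀, hP₀⟩ := exists_rt_eq_of_blk_eq c hZ.symm
  have hx := card_fib_sdiff_eq_of_rt_eq hw hk hc2 hwc h1 hm hΨ hg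
  have hall : ∀ a : ZMod (2 ^ k), ddist (arcType hw hk hc2 hwc a) Ψ = ddist (arcType hw hk hc2 hwc 0) Ψ := by
    intro a
    rw [ddist_arcType_eq_sum hw hk hc2 hwc, ddist_arcType_eq_sum hw hk hc2 hwc]
    exact sum_congr rfl fun i _ => by rw [hx, hx]
  obtain ⟨hb, -, -⟩ := bpot_eq_ddist_zero_of_subBalanced hw hk hc2 hwc h1 hm (X := Ψ) (fun j _ => (hx _).le)
  rw [← hP₀, bpot_rt, show P = P₀ * (P₀⁻¹ * P) by rw [mul_inv_cancel_left], rt_mul, ddist_rt, rt_arcType_zero_eq, hall, hb]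

/-! ## §3 The excluded block misses the sub-balanced types -/

/-- **THE EXCLUDED BLOCK MISSES THE SUB-BALANCED TYPES**: a sub-balanced `Z` with `x_0(Z) = m` whose bottom deviation points lie in `B = T_0 ∖ X_B` (`|B| = m`),
lying in the block of a type `X''` of potential `m` whose block is not that of `X_B`, does not exist. [folklore] -/
theorem blk_ne_of_subBalanced (hw : ∀ P Q : G, w (P * Q) = w P + w Q) (hk : 1 ≤ k) (hc2 : c * c = 1) (hwc : w c ≠ 0)
    (h1 : ∃ g₁ : G, w g₁ = 1) {m : ℕ} (hm : 2 * m = (univ.filter fun s : G => w s = 0).card)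
    {XB X'' Z : CMF G c} {B : Finset G} (hXB : (arcType hw hk hc2 hwc 0).1 \ XB.1 = B) (hBm : B.card = m) (hpotX'' : bpot c (arcType hw hk hc2 hwc 0) X'' = m)
    (hne : blk c X'' ≠ blk c XB)
    (hZ : ∀ j : ℕ, j < 2 ^ (k - 1) → ((univ.filter fun s : G => w s = (j : ZMod (2 ^ k))) \ Z.1).card ≤ m)
    (hZ0 : ((univ.filter fun s : G => w s = 0) \ Z.1).card = m) (hZB : ∀ P ∈ (arcType hw hk hc2 hwc 0).1 \ Z.1, w P = 0 → P ∈ B) :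
    blk c Z ≠ blk c X'' := by
  intro hblk
  obtain ⟨P, hP⟩ := exists_rt_eq_of_blk_eq c hblk.symm
  have hpotZ : bpot c (arcType hw hk hc2 hwc 0) Z = m := by rw [← hP, bpot_rt, hpotX'']
  obtain ⟨hb, -, -⟩ := bpot_eq_ddist_zero_of_subBalanced hw hk hc2 hwc h1 hm hZ
  -- `ddist T_0 Z = m = x_0(Z)`: every deviation point of `Z` is a bottom point
  have hd0 : ((arcType hw hk hc2 hwc 0).1 \ Z.1).card = m := by have := hb.symm.trans hpotZ; exact this
  have hsub : (univ.filter fun s : G => w s = 0) \ Z.1 ⊆ (arcType hw hk hc2 hwc 0).1 \ Z.1 := by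
    have h := fib_sdiff_eq_filter_of_lt hw hk hc2 hwc Z (j := 0) Nat.one_le_two_pow
    rw [Nat.cast_zero] at h; rw [h]; exact filter_subset _ _
  have heq : (univ.filter fun s : G => w s = 0) \ Z.1 = (arcType hw hk hc2 hwc 0).1 \ Z.1 := eq_of_subset_of_card_le hsub (by rw [hZ0, hd0])
  have hdevB : (arcType hw hk hc2 hwc 0).1 \ Z.1 ⊆ B := fun P hP' => hZB P hP' (by rw [← heq] at hP'; exact (mem_filter.mp (mem_sdiff.mp hP').1).2)
  have hdev : (arcType hw hk hc2 hwc 0).1 \ Z.1 = B := eq_of_subset_of_card_le hdevB (by rw [hBm, hd0])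
  exact hne (hblk.symm.trans (congrArg (blk c) (eq_of_sdiff_eq (hdev.trans hXB.symm))))

/-! ## §4 The spectator ties -/

/-- **THE SPECTATOR TIE `X_B^{(u)}`** (`w u = j`, `1 ≤ j ≤ h − 2`): its deviation is `insert u B`, it is sub-balanced with `x_{h−1} < m`, and its bottom
deviation points lie in `B`. [folklore] -/
theorem spectatorTie_spec (hw : ∀ P Q : G, w (P * Q) = w P + w Q) (hk : 1 ≤ k) (hc2 : c * c = 1) (hwc : w c ≠ 0)
    {m : ℕ} {XB : CMF G c} {B : Finset G} (hXB : (arcType hw hk hc2 hwc 0).1 \ XB.1 = B)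
    (hBF : B ⊆ univ.filter fun s : G => w s = 0) (hBm : B.card = m) (hm1 : 1 ≤ m) {u : G} {j : ℕ} (hj1 : 1 ≤ j) (hj : j ≤ 2 ^ (k - 1) - 2)
    (hu : w u = (j : ZMod (2 ^ k))) :
    (arcType hw hk hc2 hwc 0).1 \ (oflipCM c hc2 u XB).1 = insert u B ∧
    (∀ i : ℕ, i < 2 ^ (k - 1) → ((univ.filter fun s : G => w s = (i : ZMod (2 ^ k))) \ (oflipCM c hc2 u XB).1).card ≤ m) ∧
    ((univ.filter fun s : G => w s = ((2 ^ (k - 1) - 1 : ℕ) : ZMod (2 ^ k))) \ (oflipCM c hc2 u XB).1).card < m ∧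
    (∀ P ∈ (arcType hw hk hc2 hwc 0).1 \ (oflipCM c hc2 u XB).1, w P = 0 → P ∈ B) := by
  have huT : u ∈ (arcType hw hk hc2 hwc 0).1 := (mem_arcType_iff_exists hw hk hc2 hwc 0 u).mpr ⟨j, by omega, by rw [hu, zero_add]⟩
  have hu0 : w u ≠ 0 := fun h => by
    rw [hu, ← Nat.cast_zero] at h; have := natCast_inj_of_lt_half hk (by omega) (by omega) h; omega
  have huB : u ∉ B := fun h => hu0 (mem_filter.mp (hBF h)).2
  have huX : u ∈ XB.1 := by by_contra h; exact huB (hXB ▸ mem_sdiff.mpr ⟨huT, h⟩)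
  have hdev : (arcType hw hk hc2 hwc 0).1 \ (oflipCM c hc2 u XB).1 = insert u B := by rw [dev_oflip_of_mem c hc2 huT huX, hXB]
  refine ⟨hdev, fun i hi => ?_, ?_, fun P hP hP0 => ?_⟩
  · rw [fib_sdiff_eq_filter_of_lt hw hk hc2 hwc _ hi, hdev, filter_insert]
    by_cases h : w u = (i : ZMod (2 ^ k))
    · rw [if_pos h]
      have hB0 : B.filter (fun s => w s = (i : ZMod (2 ^ k))) = ∅ := by
        rw [filter_eq_empty_iff]; intro x hx hxi
        have := (mem_filter.mp (hBF hx)).2; rw [this] at hxi; exact hu0 (h.trans hxi.symm)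
      rw [hB0, insert_empty, card_singleton]; exact hm1
    · rw [if_neg h]; exact (card_le_card (filter_subset _ _)).trans hBm.le
  · rw [fib_sdiff_eq_filter_of_lt hw hk hc2 hwc _ (by omega), hdev, filter_insert, if_neg, filter_eq_empty_iff.mpr, card_empty]
    · omega
    · intro x hx hxi
      have h0 := (mem_filter.mp (hBF hx)).2
      rw [h0, ← Nat.cast_zero] at hxi
      have := natCast_inj_of_lt_half hk (by omega) (by omega) hxi; omega
    · rw [hu]; intro h; have := natCast_inj_of_lt_half hk (by omega) (by omega) h; omega
  · rw [hdev, mem_insert] at hP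
    rcases hP with rfl | hP
    · exact absurd hP0 hu0
    · exact hP

/-! ## §5 The top unit shift -/

/-- **THE TOP UNIT SHIFT** from the top arc shift and the interior unit shifts: for `w u = h − 1`,
`unit_0(u) = Y(u) − Σ_{a=1}^{h−2} unit_a(u)`, the `unit_a(u)` being base changes of interior unit shifts. [folklore] -/
theorem unitShift_top_mem (hw : ∀ P Q : G, w (P * Q) = w P + w Q) (hk : 1 ≤ k) (hk2 : 2 ≤ k) (hc2 : c * c = 1)
    (hcen : ∀ x : G, x * c = c * x) (hwc : w c ≠ 0) (S : Finset (CMF G c →₀ ℤ))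
    (hunit : ∀ j : ℕ, 1 ≤ j → j ≤ 2 ^ (k - 1) - 2 → ∃ u₀ : G, w u₀ = (j : ZMod (2 ^ k)) ∧
      (Finsupp.single (oflipCM c hc2 u₀ (arcType hw hk hc2 hwc 0)) (1 : ℤ) - Finsupp.single (arcType hw hk hc2 hwc 0) 1) -
        (Finsupp.single (oflipCM c hc2 u₀ (arcType hw hk hc2 hwc 1)) (1 : ℤ) - Finsupp.single (arcType hw hk hc2 hwc 1) 1) ∈
          Submodule.span ℤ (pairSet c) ⊔ Submodule.span ℤ (translates c S))
    {u : G} (hu : w u = ((2 ^ (k - 1) - 1 : ℕ) : ZMod (2 ^ k)))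
    (hY : Finsupp.single (oflipCM c hc2 u (arcType hw hk hc2 hwc 0)) (1 : ℤ) - Finsupp.single (arcType hw hk hc2 hwc 0) 1 -
        Finsupp.single (oflipCM c hc2 u (arcType hw hk hc2 hwc (w u))) 1 + Finsupp.single (arcType hw hk hc2 hwc (w u)) 1 ∈
      Submodule.span ℤ (pairSet c) ⊔ Submodule.span ℤ (translates c S)) :
    (Finsupp.single (oflipCM c hc2 u (arcType hw hk hc2 hwc 0)) (1 : ℤ) - Finsupp.single (arcType hw hk hc2 hwc 0) 1) -
        (Finsupp.single (oflipCM c hc2 u (arcType hw hk hc2 hwc 1)) (1 : ℤ) - Finsupp.single (arcType hw hk hc2 hwc 1) 1) ∈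
      Submodule.span ℤ (pairSet c) ⊔ Submodule.span ℤ (translates c S) := by
  set L := Submodule.span ℤ (pairSet c) ⊔ Submodule.span ℤ (translates c S) with hL
  have hh2 : 2 ≤ 2 ^ (k - 1) := le_trans (pow_one 2).symm.le (Nat.pow_le_pow_right (by norm_num) (by omega))
  -- telescoping: `ε_1(u) − ε_{b+1}(u) ∈ L` for `b ≤ h − 2`
  have htel : ∀ b : ℕ, b ≤ 2 ^ (k - 1) - 2 →
      (Finsupp.single (oflipCM c hc2 u (arcType hw hk hc2 hwc 1)) (1 : ℤ) - Finsupp.single (arcType hw hk hc2 hwc 1) 1) -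
        (Finsupp.single (oflipCM c hc2 u (arcType hw hk hc2 hwc ((b + 1 : ℕ) : ZMod (2 ^ k)))) (1 : ℤ) -
          Finsupp.single (arcType hw hk hc2 hwc ((b + 1 : ℕ) : ZMod (2 ^ k))) 1) ∈ L := by
    intro b hb
    induction b with
    | zero => rw [Nat.zero_add, Nat.cast_one, sub_self]; exact Submodule.zero_mem _
    | succ b ih =>
      -- `unit_{b+1}(u)` is the base change of the interior unit shift at position `h − 2 − b`
      obtain ⟨u₁, hu₁, hU₁⟩ := hunit (2 ^ (k - 1) - 1 - (b + 1)) (by omega) (by omega)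
      have ha₁ : w u = w u₁ + ((b + 1 : ℕ) : ZMod (2 ^ k)) := by
        rw [hu, hu₁, ← Nat.cast_add]; congr 1; omega
      have hT₁ := unitShift_transport hw hk hc2 hcen hwc S ha₁ hU₁
      have e : ((b + 1 : ℕ) : ZMod (2 ^ k)) + 1 = ((b + 1 + 1 : ℕ) : ZMod (2 ^ k)) := by push_cast; ring
      rw [e] at hT₁
      have h := Submodule.add_mem _ (ih (by omega)) hT₁
      convert h using 1
      abel
  have htop := htel (2 ^ (k - 1) - 2) le_rfl
  have e : ((2 ^ (k - 1) - 2 + 1 : ℕ) : ZMod (2 ^ k)) = w u := by rw [hu]; congr 1; omega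
  rw [e] at htop
  have h := Submodule.sub_mem _ hY htop
  convert h using 1
  abel

/-- **ALL UNIT SHIFTS of the points of `T_0`** from the interior ones and `ζ`: for `q ∈ T_0` with `w q ≠ 0`, `unit_0(q) ∈ L` (`k ≥ 2`). [folklore] -/
theorem unitShift_all_mem (hw : ∀ P Q : G, w (P * Q) = w P + w Q) (hk : 1 ≤ k) (hk2 : 2 ≤ k) (hc2 : c * c = 1)
    (hcen : ∀ x : G, x * c = c * x) (hwc : w c ≠ 0) (S : Finset (CMF G c →₀ ℤ))
    (hunit : ∀ j : ℕ, 1 ≤ j → j ≤ 2 ^ (k - 1) - 2 → ∃ u₀ : G, w u₀ = (j : ZMod (2 ^ k)) ∧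
      (Finsupp.single (oflipCM c hc2 u₀ (arcType hw hk hc2 hwc 0)) (1 : ℤ) - Finsupp.single (arcType hw hk hc2 hwc 0) 1) -
        (Finsupp.single (oflipCM c hc2 u₀ (arcType hw hk hc2 hwc 1)) (1 : ℤ) - Finsupp.single (arcType hw hk hc2 hwc 1) 1) ∈
          Submodule.span ℤ (pairSet c) ⊔ Submodule.span ℤ (translates c S))
    {t : G} (ht : w t = 0)
    (hζ : (Finsupp.single (oflipCM c hc2 t (arcType hw hk hc2 hwc 0)) (1 : ℤ) - Finsupp.single (arcType hw hk hc2 hwc 0) 1) +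
        (Finsupp.single (oflipCM c hc2 t (arcType hw hk hc2 hwc 1)) (1 : ℤ) - Finsupp.single (arcType hw hk hc2 hwc 1) 1) ∈
          Submodule.span ℤ (pairSet c) ⊔ Submodule.span ℤ (translates c S))
    {q : G} (hqT : q ∈ (arcType hw hk hc2 hwc 0).1) (hq0 : w q ≠ 0) :
    (Finsupp.single (oflipCM c hc2 q (arcType hw hk hc2 hwc 0)) (1 : ℤ) - Finsupp.single (arcType hw hk hc2 hwc 0) 1) -
        (Finsupp.single (oflipCM c hc2 q (arcType hw hk hc2 hwc 1)) (1 : ℤ) - Finsupp.single (arcType hw hk hc2 hwc 1) 1) ∈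
      Submodule.span ℤ (pairSet c) ⊔ Submodule.span ℤ (translates c S) := by
  obtain ⟨j, hj, hqj⟩ := (mem_arcType_iff_exists hw hk hc2 hwc 0 q).mp hqT
  rw [zero_add] at hqj
  have hj0 : j ≠ 0 := fun h => hq0 (by rw [hqj, h, Nat.cast_zero])
  by_cases htop : j = 2 ^ (k - 1) - 1
  · rw [htop] at hqj
    have hu : w q = ((2 ^ (k - 1) : ℕ) : ZMod (2 ^ k)) - 1 := by rw [hqj, natCast_half_sub_one]
    have hY := shiftTop_mem_of_zeta_mem hw hk hc2 hcen hwc S ht hu hζ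
    exact unitShift_top_mem hw hk hk2 hc2 hcen hwc S hunit hqj hY
  · obtain ⟨u₀, hu₀, hU⟩ := hunit j (Nat.pos_of_ne_zero hj0) (by omega)
    have h := unitShift_transport hw hk hc2 hcen hwc S (u := q) (a := 0) (by rw [hqj, hu₀, add_zero]) hU
    rwa [zero_add] at h

/-- **A PURE BOTTOM TIE IS SUB-BALANCED with `x_{h−1} = 0`** and its deviation points are bottom points (`k ≥ 2`, `m ≥ 1`). [folklore] -/
theorem subBalanced_of_pureTie (hw : ∀ P Q : G, w (P * Q) = w P + w Q) (hk : 1 ≤ k) (hk2 : 2 ≤ k) (hc2 : c * c = 1) (hwc : w c ≠ 0)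
    {m : ℕ} (hm1 : 1 ≤ m) {X : CMF G c} {B : Finset G} (hX : (arcType hw hk hc2 hwc 0).1 \ X.1 = B)
    (hBF : B ⊆ univ.filter fun s : G => w s = 0) (hBm : B.card = m) :
    (∀ i : ℕ, i < 2 ^ (k - 1) → ((univ.filter fun s : G => w s = (i : ZMod (2 ^ k))) \ X.1).card ≤ m) ∧
    ((univ.filter fun s : G => w s = ((2 ^ (k - 1) - 1 : ℕ) : ZMod (2 ^ k))) \ X.1).card < m ∧
    (∀ P ∈ (arcType hw hk hc2 hwc 0).1 \ X.1, w P = 0 → P ∈ B) := by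
  have hh2 : 2 ≤ 2 ^ (k - 1) := le_trans (pow_one 2).symm.le (Nat.pow_le_pow_right (by norm_num) (by omega))
  refine ⟨fun i hi => ?_, ?_, fun P hP _ => hX ▸ hP⟩
  · rw [fib_sdiff_eq_filter_of_lt hw hk hc2 hwc _ hi, hX]; exact (card_le_card (filter_subset _ _)).trans hBm.le
  · rw [fib_sdiff_eq_filter_of_lt hw hk hc2 hwc _ (by omega), hX, filter_eq_empty_iff.mpr, card_empty]
    · omega
    · intro x hx hxi
      have h0 := (mem_filter.mp (hBF hx)).2
      rw [h0, ← Nat.cast_zero] at hxi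
      have := natCast_inj_of_lt_half hk (by omega) (by omega) hxi; omega

end

end Summit.HodgeConjecture.CorCM.Census.CyclicCharacter
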